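import Literature.Analysis.OperatorTheory.Enflo2023.CaseIIEndgame
import Literature.Analysis.OperatorTheory.Enflo2023.CaseIIMinimal
import HarnessLib

/-!
# Enflo (2023), arXiv:2305.15442v2, p. 13, (26)–(27): how far the minimal solution of (26) actually moves, and what
# the Case II branch really consumes — (27) is not needed

SOURCE (v2 = `Enflo_06_April_2024-arXiv.tex` L406–L431, p. 13; the Case I / Case II argument, (26), (27) and the
factor `1 − 1/20` are NEW in v2 — v1 `Enflo_23_May_2023.tex` has no such text):
"For `δ = εθ/10` let `‖ℓ'(T)‖₂` be minimal for `‖x₀ − ℓ'(T)y₁'‖ ≤ ‖x₀ − (1+δ)y₁'‖` (26).  We get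
`‖ℓ'(T)y₁' − (1+δ)y₁'‖ < (εθ)²` (27). … Equation (27) gives `⟨ℓ'(T)y₁', x₀ − ℓ'(T)y₁'⟩ < εθ(1 − 1/20)`, so we can
now use Lemma 2 again, letting `ℓ'(T)y₁'` of (27) playing the role of `ℓ(T)y` in Lemma 2, and letting
`ℓ'(T)y₁' = y₁''` … play the role of `y₁'` in Lemma 2 and letting
`(εθ)' = ⟨y₁'', x₀ − y₁''⟩ = ⟨ℓ'(T)y₁', x₀ − ℓ'(T)y₁'⟩ < εθ(1 − 1/20)` play the role of `εθ` in Lemma 2.  Thus, every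
time we apply Lemma 2 we either get Case I and we are done, or we get Case II and pass to a smaller `εθ`, diminished
by a factor `(1 − 1/20)`, and not moving more than `(εθ)²` by (27).  So, if Case II happens every time we obtain
convergence to a non-cyclic vector." (L406–L431, verbatim up to notation.)

WHAT THE TREE ALREADY HAS.  (27) is false for THE minimal solution of (26) in the text's own regime
(`CaseII.eq27_false_for_minimal`, file `CaseIIMinimal.lean`; window/inference forms `CaseII.eq27_false_in_window`,
`CaseII.not_eq27Inference`, `not_eq27InferenceSA`, `not_eq27InferenceCyc`), and the Case II branch was assembled
CONDITIONALLY ON (27) (`CaseII.hasNontrivialClosedInvariantSubspace_of_run`, `…_of_eq27_along_runs`, file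
`CaseIIEndgame.lean`), where (27) delivered both the summability of the moves (`CaseII.step_move_le`) and the
contraction of `εθ` (`CaseII.etheta_succ_le`).

WHAT THIS FILE ADDS (theorems about the text; the only smallness used is `‖T‖ ≤ 10⁻²⁰`, as everywhere in Part A).
* `norm_sq_sub_eq_of_kkt`, `norm_sq_move_eq` — the MOVE IDENTITY: at the minimal solution `a` of (26) (constraint
  active, multiplier `C'` of (5)), `‖ℓ'(T)y₁' − (1+δ)y₁'‖² = 2C'·((1+δ)Re a₀ − ‖a‖²)`.
* `head_eq`, `head_re_eq` — (5) at `j = 0`: `(C' + ‖y‖²)a₀ = ⟨y, x₀⟩ − a₁⟨y, Ty⟩ − ⟨y, T²V_y L²a⟩`, so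
  `(C' + ‖y‖²)Re a₀ = εθ + ‖y‖² − E` with `|E| ≤ (10⁻²⁰ + 2·10⁻⁴⁰)‖La‖`.
* `minimal_facts`, `norm_sq_move_le`, `norm_move_le` — the MOVE BOUND, unconditionally, for THE minimiser:
  `‖ℓ'(T)y₁' − (1+δ)y₁'‖² ≤ 9C'² + 21·10⁻⁴⁰C'`, and if the new `(εθ)' ≤ 10⁻⁴` then
  `‖ℓ'(T)y₁' − (1+δ)y₁'‖ ≤ 4(εθ)' + 5·10⁻²⁰√(εθ)'` (using `C' ≤ 1.005(εθ)'`, from `Re a₀ ≥ 0.9977`).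
  So the true size of the move is `O((εθ)')` (plus an operator-tail term `10⁻²⁰√(εθ)'`), against the text's `(εθ)²`:
  (27) over-claims by one order in `εθ` — but the moves ARE summable along any run on which `εθ → 0` geometrically.
* Section `CRun`, `hasNontrivialClosedInvariantSubspace_of_contraction_along_runs`,
  `hasNontrivialClosedInvariantSubspace_of_factor_along_runs` — the Case II branch RE-ASSEMBLED with the contraction
  `(εθ)_{n+1} ≤ r·(εθ)_n` (any `0 ≤ r < 1` with `100(εθ)₀² ≤ 1 − r`; the text's `r = 1 − 1/20` qualifies since
  `(εθ)₀ ≤ 10⁻⁴`) as the ONLY unproved ingredient: convergence in norm (`crun_move_le`, `crun_limit`: geometric majorant of ratio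
  `√r`), `x₀ − y_∞ ≠ 0` (`crun_norm_sub_sq_ge`: the ACTIVE constraint of (26) loses at most `(εθ)_n²/5` of
  `‖x₀ − y_n‖²` per step, and `Σ(εθ)_n² ≤ (εθ)₀²/(1−r)`), orthogonality of the limit orbit by (9) + (11)
  (`Vy.eq9_pow`, `orbit_orthogonal_of_norm_limit`), invariant subspace (`…_of_contraction_along_runs`).
* `kkt_head_displacement`, `mul_re_head_eq_sub`, `kkt_coeff_of_orthogonal`, `inner_sub_V_of_caseII_exact`,
  `norm_sq_displacement_eq`, `norm_displacement_le` — the STRUCTURE the contraction question is about: with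
  `w := ℓ'(T)y − y`, `C'·Re a₀ = εθ − Re⟨y, w⟩` (so, by (6), `εθ` contracts by the factor `≈ 1 − Re⟨y, w⟩/εθ`, the
  progress of the move along `y`; the scaling alone gives `εθ‖y‖²/10 ≥ εθ/20` because `‖y‖² ≥ 1/2`); under EXACT
  Case II, `C'a_j = −⟨T^j y, w⟩` for `j ≥ 1` (THE minimiser is the Tikhonov solution
  `e₀ + (εθ − C')(C' + V_y†V_y)⁻¹e₀`, `C'` fixed by activity) and `‖w‖² = δ²‖y‖² − 2εθ((1+δ) − Re a₀) ≤ δ²‖y‖²`.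

FINDING (repair cell pub-enflo, F1 gen 6).  For the convergence asserted after (27), the estimate (27) is NOT NEEDED:
the Case II branch consumes exactly ONE unproved statement, the uniform contraction "`(εθ)' < εθ(1 − 1/20)`" for the
minimal solution of (26) at every stage of the run.  The text obtains that contraction from (27) alone ("Equation (27)
gives …", L421–L423), and (27) is refuted (`eq27_false_for_minimal`); no other argument for it is offered.  The
standing verdict "first non-following step of Part A = (27), p. 13" is thereby SHARPENED, not moved: (27) as printed
is false yet immaterial (`norm_move_le`); the load-bearing unproved claim on p. 13 is the contraction itself
(L421–L423).  What is known about it for THE minimiser: the pure scaling `a = (1+δ)e₀` would give the factor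
`1 − ‖y‖²/10 ≤ 19/20` (as `‖y‖² ≥ 1/2`), but norm-minimality lowers `a₀` and adds `a₁Ty + …`; under EXACT Case II
the two-sided law of `CaseIIFactor.lean` (`CaseII.etheta_succ_law`, F1 gen 6) gives `(εθ)' ≈ εθ·(1 − S/10)` with
`‖y‖² − κ²/σ² ≤ S ≤ ‖y‖² − κ²/(1.1εθ + σ²)` (`κ = |⟨y,Ty⟩|`, `σ = ‖Ty‖`; `‖y‖² − κ²/σ² = ‖y‖² sin²∠(y,Ty)`): the
text's factor while `εθ ≫ σ²`, but `1 − ‖y‖² sin²∠(y,Ty)/10 + o(1)` deep in a run (`εθ ≪ σ²`), which exceeds `19/20`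
as soon as `cos²∠(y,Ty) > 1 − 0.49/‖y‖²` (`CaseII.factor_false_for_minimal`, with a `ℂ³` witness
`CaseII.factor_false_satisfiable`) and stays `≤ 19/20` when `‖y‖² sin²∠(y,Ty) ≥ 3/5` (`CaseII.factor_of_large_angle`).
Packet: `REPAIR-CENSUS.md` F1-V8, `GAP.md` §F1.

All constants (`9`, `21·10⁻⁴⁰`, `4`, `5·10⁻²⁰`, `1.0001`, `0.0899`, `0.9977`, `0.088`, `41/10`) are reproduced in
the proofs [b2b].  No declaration of this file concludes the invariant-subspace statement for an arbitrary operator: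
the two closing theorems carry the contraction hypothesis `hcontr` explicitly.
-/

open scoped InnerProductSpace ENNReal
open Filter
open _root_.Topology
open Literature.Analysis.UnboundedOperators (inner_self_eq_coe_norm_sq)

noncomputable section

namespace Literature.Analysis.OperatorTheory.Enflo2023

namespace CaseII

open Vy

variable {H : Type*} [NormedAddCommGroup H] [InnerProductSpace ℂ H] [CompleteSpace H]

/-! ### The move identity: `‖V a − V b‖² = 2C'(Re⟨a, b⟩ − ‖a‖²)` at an active KKT point -/

/-- **Move identity (abstract).**  If `V†(x₀ − V a) = C'·a` (the Lagrange identity (5)) and the constraint is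
active at `a` with the same value as at a competitor `b`, `‖x₀ − V a‖ = ‖x₀ − V b‖`, then
`‖V a − V b‖² = 2C'·(Re⟪a, b⟫ − ‖a‖²)`.  (Expand `‖x₀ − V b‖² = ‖(x₀ − V a) + V(a − b)‖²` and use (5):
`⟪x₀ − V a, V r⟫ = C'⟪a, r⟫`.) [cite: Enflo2023, v2 p.3, eq. (5); p.13, eq. (26)] -/
theorem norm_sq_sub_eq_of_kkt {E : Type*} [NormedAddCommGroup E] [InnerProductSpace ℂ E]
    [CompleteSpace E] (V : E →L[ℂ] H) (x₀ : H) (a b : E) {C : ℝ}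
    (hC : ContinuousLinearMap.adjoint V (x₀ - V a) = (C : ℂ) • a)
    (hact : ‖x₀ - V a‖ = ‖x₀ - V b‖) :
    ‖V a - V b‖ ^ 2 = 2 * C * ((⟪a, b⟫_ℂ).re - ‖a‖ ^ 2) := by
  have h1 : x₀ - V b = (x₀ - V a) + V (a - b) := by rw [map_sub]; abel
  have h2 := norm_add_sq (𝕜 := ℂ) (x₀ - V a) (V (a - b))
  rw [← h1, ← hact, IsMinimal.eq5 hC (a - b), inner_sub_right, inner_self_eq_coe_norm_sq] at h2
  have h3 : ‖V (a - b)‖ = ‖V a - V b‖ := by rw [map_sub]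
  rw [h3] at h2
  simp only [RCLike.re_to_complex, Complex.mul_re, Complex.sub_re, Complex.sub_im,
    Complex.ofReal_re, Complex.ofReal_im, zero_mul, sub_zero] at h2
  linarith

/-- **Move identity for (26).**  For the paper's `V_y` and the comparison point `c·y = V_y(c e₀)` (`c = 1+δ`
real): if (5) holds at `a` with multiplier `C'` and `‖x₀ − V_y a‖ = ‖x₀ − c y‖` (the constraint of (26) is
active — as it is at the minimal solution, `IsMinimal.norm_sub_eq`), then
`‖V_y a − c y‖² = 2C'·(c·Re a₀ − ‖a‖²)`.  So the size of the move `ℓ'(T)y₁' − (1+δ)y₁'` is governed by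
the multiplier `C' = (εθ)'/‖ℓ'‖²` and the head deficit `c·Re a₀ − ‖a‖² ≤ (1+δ)(1+δ − Re a₀)`. [cite: Enflo2023, v2 p.13, eq. (26)–(27)] -/
theorem norm_sq_move_eq (T : H →L[ℂ] H) (hT : ‖T‖ < 1) (x₀ y : H) (a : ℓ2) (c : ℝ) {C : ℝ}
    (hC : ContinuousLinearMap.adjoint (V T hT y) (x₀ - V T hT y a) = (C : ℂ) • a)
    (hact : ‖x₀ - V T hT y a‖ = ‖x₀ - (c : ℂ) • y‖) :
    ‖V T hT y a - (c : ℂ) • y‖ ^ 2 = 2 * C * (c * (a 0).re - ‖a‖ ^ 2) := by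
  classical
  have hb : V T hT y ((c : ℂ) • (lp.single 2 0 (1 : ℂ) : ℓ2)) = (c : ℂ) • y :=
    V_smul_single_zero T hT y c
  have h := norm_sq_sub_eq_of_kkt (V T hT y) x₀ a ((c : ℂ) • (lp.single 2 0 (1 : ℂ) : ℓ2)) hC
    (by rw [hb]; exact hact)
  rw [hb, inner_smul_right, lp.inner_single_right] at h
  rw [h]
  have h5 : ((c : ℂ) * ⟪a 0, (1 : ℂ)⟫_ℂ).re = c * (a 0).re := by
    simp [Complex.mul_re]
  rw [h5]

/-! ### The head equation: (5) at `j = 0` for `V_y a = a₀ y + a₁ Ty + T²V_y(L²a)` -/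

/-- **(5) at `j = 0`, solved for the head coefficient**: with `V_y a = a₀y + a₁Ty + t`, `t = T²V_y(L²a)`,
`(C' + ‖y‖²)·a₀ = ⟪y, x₀⟫ − a₁⟪y, Ty⟫ − ⟪y, t⟫` (paper: `⟨x₀ − ℓ'(T)y, y⟩ = C'a₀`). [cite: Enflo2023, v2 p.3, eq. (5); pp.12–13] -/
theorem head_eq (T : H →L[ℂ] H) (hT : ‖T‖ < 1) (x₀ y : H) (a : ℓ2) {C : ℝ}
    (hC : ContinuousLinearMap.adjoint (V T hT y) (x₀ - V T hT y a) = (C : ℂ) • a) :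
    ((C : ℂ) + ((‖y‖ ^ 2 : ℝ) : ℂ)) * a 0
      = ⟪y, x₀⟫_ℂ - a 1 * ⟪y, T y⟫_ℂ - ⟪y, T (T (V T hT y (L (L a))))⟫_ℂ := by
  have hk0 := kkt_coord T hT y x₀ a hC 0
  rw [pow_zero, one_apply_eq_self, V_decomp₂ T hT y a] at hk0
  rw [inner_sub_right, inner_add_right, inner_add_right, inner_smul_right, inner_smul_right,
    inner_self_eq_coe_norm_sq] at hk0
  linear_combination (-1 : ℂ) * hk0

/-- Real part of the head equation: if `Re⟪x₀ − y, y⟫ = εθ` then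
`(C' + ‖y‖²)·Re a₀ = εθ + ‖y‖² − Re(a₁⟪y, Ty⟫ + ⟪y, t⟫)`. [cite: Enflo2023, v2 p.3, eq. (5); pp.12–13] -/
theorem head_re_eq (T : H →L[ℂ] H) (hT : ‖T‖ < 1) (x₀ y : H) (et : ℝ) (a : ℓ2) {C : ℝ}
    (ht : (⟪x₀ - y, y⟫_ℂ).re = et)
    (hC : ContinuousLinearMap.adjoint (V T hT y) (x₀ - V T hT y a) = (C : ℂ) • a) :
    (C + ‖y‖ ^ 2) * (a 0).re
      = et + ‖y‖ ^ 2 - (a 1 * ⟪y, T y⟫_ℂ + ⟪y, T (T (V T hT y (L (L a))))⟫_ℂ).re := by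
  have h := congrArg Complex.re (head_eq T hT x₀ y a hC)
  have hyx : (⟪y, x₀⟫_ℂ).re = et + ‖y‖ ^ 2 := by
    have h1 := inner_re_symm (𝕜 := ℂ) y x₀
    simp only [RCLike.re_to_complex] at h1
    have h2 : (⟪x₀ - y, y⟫_ℂ).re = (⟪x₀, y⟫_ℂ).re - ‖y‖ ^ 2 := by
      rw [inner_sub_left, Complex.sub_re, inner_self_eq_coe_norm_sq, Complex.ofReal_re]
    linarith
  have h4 : (a 1 * ⟪y, T y⟫_ℂ + ⟪y, T (T (V T hT y (L (L a))))⟫_ℂ).re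
      = (a 1).re * (⟪y, T y⟫_ℂ).re - (a 1).im * (⟪y, T y⟫_ℂ).im
        + (⟪y, T (T (V T hT y (L (L a))))⟫_ℂ).re := by
    simp only [Complex.add_re, Complex.mul_re]
  simp only [Complex.mul_re, Complex.add_re, Complex.sub_re, Complex.add_im, Complex.ofReal_re,
    Complex.ofReal_im, add_zero] at h
  rw [hyx] at h
  rw [h4]
  linarith [h]

/-! ### Real-arithmetic cores (kept separate so that the vector statements elaborate quickly) -/

omit [CompleteSpace H] in
/-- Numerical bookkeeping: `‖y‖·(1 − ‖T‖²)^{-1/2} ≤ 1 + 10⁻⁴` for `‖y‖ ≤ 1`, `‖T‖ ≤ 10⁻²⁰` (so `‖V_y‖ ≤ 1.0001`). [folklore] -/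
lemma norm_y_mul_sqrt_le {T : H →L[ℂ] H} (hT : ‖T‖ ≤ 1 / 10 ^ 20) {y : H} (hy1 : ‖y‖ ≤ 1) :
    ‖y‖ * Real.sqrt (1 / (1 - ‖T‖ ^ 2)) ≤ 1 + 1 / 10 ^ 4 := by
  have hq0 : 0 ≤ ‖T‖ := norm_nonneg _
  have hq2 : ‖T‖ ^ 2 ≤ 1 / 10 ^ 40 := (pow_le_pow_left₀ hq0 hT 2).trans (by norm_num)
  have hpos : 0 < 1 - ‖T‖ ^ 2 := by linarith
  have hy0 : 0 ≤ ‖y‖ := norm_nonneg y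
  have hs0 : 0 ≤ Real.sqrt (1 / (1 - ‖T‖ ^ 2)) := Real.sqrt_nonneg _
  have hy2 : ‖y‖ ^ 2 ≤ 1 := by nlinarith
  have hys2 : (‖y‖ * Real.sqrt (1 / (1 - ‖T‖ ^ 2))) ^ 2 ≤ (1 + 1 / 10 ^ 4) ^ 2 := by
    rw [mul_pow, Real.sq_sqrt (by positivity), one_div, ← div_eq_mul_inv, div_le_iff₀ hpos]
    nlinarith
  exact (pow_le_pow_iff_left₀ (mul_nonneg hy0 hs0) (by norm_num) two_ne_zero).mp hys2

/-- Real arithmetic core of the move bound: from the move identity (`M = 2C'(c u − ‖a‖²)`), the head equation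
`(C' + Y)u = εθ + Y − E`, `|E| ≤ (10⁻²⁰ + 2·10⁻⁴⁰)A`, the budget `u² + A² ≤ ‖a‖² ≤ c²`, `Y ∈ [1/2, 1]`,
`c = 1 + εθ/10 ≤ 1 + 10⁻⁵`: `M ≤ 9C'² + 21·10⁻⁴⁰C'`. [folklore] -/
lemma move_arith (C Y c u A na Er et : ℝ) (hC0 : 0 ≤ C) (hY : 1 / 2 ≤ Y) (hY1 : Y ≤ 1)
    (het0 : 0 ≤ et) (hc : c = 1 + et / 10) (hc2 : c ≤ 1 + 1 / 10 ^ 5)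
    (hu : u ≤ c) (hsplit : u ^ 2 + A ^ 2 ≤ na) (hna : na ≤ c ^ 2)
    (hre : (C + Y) * u = et + Y - Er) (hE : |Er| ≤ (1 / 10 ^ 20 + 2 / 10 ^ 40) * A) :
    2 * C * (c * u - na) ≤ 9 * C ^ 2 + 21 / 10 ^ 40 * C := by
  set q' : ℝ := 1 / 10 ^ 20 + 2 / 10 ^ 40 with hq'
  have hc1 : 1 ≤ c := by rw [hc]; linarith
  have hβ0 : 0 ≤ c - u := by linarith
  have hEle : Er ≤ q' * A := (le_abs_self Er).trans hE
  have hβ1 : (C + Y) * (c - u) ≤ c * C + q' * A := by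
    have e1 : (C + Y) * (c - u) = c * C + (c - 1) * Y - et + Er := by
      linear_combination (-1 : ℝ) * hre
    have e3 : (c - 1) * Y = et / 10 * Y := by rw [hc]; ring
    have e4 : et / 10 * Y ≤ et / 10 * 1 := mul_le_mul_of_nonneg_left hY1 (by linarith)
    linarith
  have hβ2 : c - u ≤ 2 * (c * C + q' * A) := by
    have e1 : (1 / 2) * (c - u) ≤ (C + Y) * (c - u) :=
      mul_le_mul_of_nonneg_right (by linarith) hβ0
    linarith
  have hA2 : A ^ 2 ≤ 2 * c * (c - u) := by
    have e1 : A ^ 2 ≤ c ^ 2 - u ^ 2 := by linarith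
    have e2 : c ^ 2 - u ^ 2 = (c - u) * (c + u) := by ring
    have e3 : (c - u) * (c + u) ≤ (c - u) * (2 * c) := mul_le_mul_of_nonneg_left (by linarith) hβ0
    linarith
  have hkey : 2 * c * (c - u) ≤ 8 * c ^ 2 * C + 16 * c ^ 2 * q' ^ 2 := by
    have e1 : 4 * c * (c - u) ≤ 4 * c * (2 * (c * C + q' * A)) :=
      mul_le_mul_of_nonneg_left hβ2 (by linarith)
    have e1' : 4 * c * (2 * (c * C + q' * A)) = 8 * c ^ 2 * C + 8 * c * (q' * A) := by ring
    have e2 : 8 * c * (q' * A) ≤ A ^ 2 + 16 * c ^ 2 * q' ^ 2 := by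
      have h := sq_nonneg (A - 4 * c * q')
      have h' : (A - 4 * c * q') ^ 2 = A ^ 2 - 8 * c * (q' * A) + 16 * c ^ 2 * q' ^ 2 := by ring
      linarith
    linarith
  have hQ : c * u - na ≤ c * (c - u) := by
    have e1 : u ^ 2 ≤ na := by nlinarith [sq_nonneg A]
    have e2 : c * (c - u) - (c * u - u ^ 2) = (c - u) ^ 2 := by ring
    nlinarith [sq_nonneg (c - u)]
  have hc22 : c ^ 2 ≤ (1 + 1 / 10 ^ 5) ^ 2 := pow_le_pow_left₀ (by linarith) hc2 2
  have hq'2 : q' ^ 2 ≤ 11 / 10 ^ 41 := by rw [hq']; norm_num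
  have hnum1 : 8 * c ^ 2 ≤ 9 := by
    have : (1 + 1 / 10 ^ 5 : ℝ) ^ 2 ≤ 9 / 8 := by norm_num
    linarith
  have hnum2 : 16 * c ^ 2 * q' ^ 2 ≤ 21 / 10 ^ 40 := by
    have h := mul_le_mul hc22 hq'2 (sq_nonneg q') (by positivity)
    have : (1 + 1 / 10 ^ 5 : ℝ) ^ 2 * (11 / 10 ^ 41) ≤ 21 / 16 / 10 ^ 40 := by norm_num
    linarith
  have hfin : 2 * C * (c * u - na) ≤ 2 * C * (c * (c - u)) :=
    mul_le_mul_of_nonneg_left hQ (by linarith)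
  calc 2 * C * (c * u - na) ≤ 2 * C * (c * (c - u)) := hfin
    _ = C * (2 * c * (c - u)) := by ring
    _ ≤ C * (8 * c ^ 2 * C + 16 * c ^ 2 * q' ^ 2) := mul_le_mul_of_nonneg_left hkey hC0
    _ = (8 * c ^ 2) * C ^ 2 + (16 * c ^ 2 * q' ^ 2) * C := by ring
    _ ≤ 9 * C ^ 2 + 21 / 10 ^ 40 * C :=
        add_le_add (mul_le_mul_of_nonneg_right hnum1 (sq_nonneg C))
          (mul_le_mul_of_nonneg_right hnum2 hC0)

/-- Real arithmetic core of the `√(εθ)'`-form: with, in addition, `(εθ)' = C'‖a‖² ≤ 10⁻⁴` and `‖a‖² ≥ 0.0899`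
(from `‖V_y a‖ ≥ 0.3`), the multiplier is `C' ≤ 1.005(εθ)'` (because `Re a₀ ≥ 0.9977`), so a move `m` with
`m² ≤ 9C'² + 21·10⁻⁴⁰C'` has `m ≤ 4(εθ)' + 5·10⁻²⁰√(εθ)'`. [folklore] -/
lemma move_arith₂ (C Y c u A na Er et ep m : ℝ) (hC0 : 0 ≤ C) (hY : 1 / 2 ≤ Y)
    (het0 : 0 ≤ et) (hc : c = 1 + et / 10) (hc2 : c ≤ 1 + 1 / 10 ^ 5)
    (hA0 : 0 ≤ A) (hu : u ≤ c) (hsplit : u ^ 2 + A ^ 2 ≤ na) (hna : na ≤ c ^ 2)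
    (hna0 : 899 / 10000 ≤ na)
    (hre : (C + Y) * u = et + Y - Er) (hE : |Er| ≤ (1 / 10 ^ 20 + 2 / 10 ^ 40) * A)
    (hep : ep = C * na) (hep1 : ep ≤ 1 / 10 ^ 4)
    (hm0 : 0 ≤ m) (hm : m ^ 2 ≤ 9 * C ^ 2 + 21 / 10 ^ 40 * C) :
    m ≤ 4 * ep + 5 / 10 ^ 20 * Real.sqrt ep := by
  set q' : ℝ := 1 / 10 ^ 20 + 2 / 10 ^ 40 with hq'
  have hq'0 : 0 ≤ q' := by rw [hq']; norm_num
  have hc1 : 1 ≤ c := by rw [hc]; linarith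
  have hep0 : 0 ≤ ep := by rw [hep]; exact mul_nonneg hC0 (by linarith)
  -- C ≤ ep / 0.0899
  have hC1 : C ≤ 1113 / 100 * ep := by
    have h1 : C * (899 / 10000) ≤ C * na := mul_le_mul_of_nonneg_left hna0 hC0
    rw [hep]; linarith
  have hC2 : C ≤ 1113 / 100 / 10 ^ 4 := hC1.trans (by linarith)
  -- A ≤ c
  have hAc : A ≤ c :=
    (pow_le_pow_iff_left₀ hA0 (by linarith) two_ne_zero).mp (by nlinarith [sq_nonneg u])
  -- Re a₀ ≥ 0.9977
  have hu1 : 9977 / 10000 ≤ u := by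
    have e1 : Y * (1 - u) = C * u - et + Er := by linear_combination (-1 : ℝ) * hre
    have e2 : C * u ≤ 1113 / 100 / 10 ^ 4 * (1 + 1 / 10 ^ 5) := by
      have h1 : C * u ≤ C * c := mul_le_mul_of_nonneg_left hu hC0
      have h2 : C * c ≤ 1113 / 100 / 10 ^ 4 * (1 + 1 / 10 ^ 5) :=
        mul_le_mul hC2 hc2 (by linarith) (by norm_num)
      linarith
    have e3 : Er ≤ q' * (1 + 1 / 10 ^ 5) := by
      have h1 : Er ≤ q' * A := (le_abs_self Er).trans hE
      have h2 : q' * A ≤ q' * (1 + 1 / 10 ^ 5) := mul_le_mul_of_nonneg_left (hAc.trans hc2) hq'0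
      exact h1.trans h2
    have e4 : q' * (1 + 1 / 10 ^ 5) ≤ 1 / 10 ^ 19 := by rw [hq']; norm_num
    have e34 : Er ≤ 1 / 10 ^ 19 := e3.trans e4
    have e5 : Y * (1 - u) ≤ 112 / 10 ^ 5 := by
      have : (1113 / 100 / 10 ^ 4 * (1 + 1 / 10 ^ 5) : ℝ) ≤ 1114 / 10 ^ 6 := by norm_num
      linarith [e1, e2, e34, het0, this]
    by_contra hcon
    push Not at hcon
    have e6 : (1 / 2) * (1 - 9977 / 10000) ≤ Y * (1 - u) := by
      have h1 : (1 / 2) * (1 - 9977 / 10000) ≤ Y * (1 - 9977 / 10000) :=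
        mul_le_mul_of_nonneg_right hY (by norm_num)
      have h2 : Y * (1 - 9977 / 10000) ≤ Y * (1 - u) :=
        mul_le_mul_of_nonneg_left (by linarith) (by linarith)
      linarith
    linarith
  -- ‖a‖² ≥ 0.9954, hence C ≤ 1.0047·(εθ)'
  have hna1 : 9954 / 10000 ≤ na := by nlinarith [sq_nonneg A]
  have hC3 : C ≤ 10047 / 10000 * ep := by
    have h1 : C * (9954 / 10000) ≤ C * na := mul_le_mul_of_nonneg_left hna1 hC0
    rw [hep]; linarith
  have hm2 : m ^ 2 ≤ 91 / 10 * ep ^ 2 + 22 / 10 ^ 40 * ep := by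
    have e1 : C ^ 2 ≤ (10047 / 10000 * ep) ^ 2 := pow_le_pow_left₀ hC0 hC3 2
    have e2 : (10047 / 10000 * ep) ^ 2 = (10047 / 10000) ^ 2 * ep ^ 2 := by ring
    have e3 : ((10047 : ℝ) / 10000) ^ 2 ≤ 101 / 100 := by norm_num
    have e4 : (10047 / 10000 : ℝ) ^ 2 * ep ^ 2 ≤ 101 / 100 * ep ^ 2 :=
      mul_le_mul_of_nonneg_right e3 (sq_nonneg ep)
    linarith
  have hR0 : 0 ≤ 4 * ep + 5 / 10 ^ 20 * Real.sqrt ep := by positivity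
  have hR2 : 91 / 10 * ep ^ 2 + 22 / 10 ^ 40 * ep ≤ (4 * ep + 5 / 10 ^ 20 * Real.sqrt ep) ^ 2 := by
    have hs : Real.sqrt ep ^ 2 = ep := Real.sq_sqrt hep0
    have hs0 : 0 ≤ Real.sqrt ep := Real.sqrt_nonneg ep
    have hcross : 0 ≤ ep * Real.sqrt ep := mul_nonneg hep0 hs0
    have hexp : (4 * ep + 5 / 10 ^ 20 * Real.sqrt ep) ^ 2
        = 16 * ep ^ 2 + 40 / 10 ^ 20 * (ep * Real.sqrt ep) + 25 / 10 ^ 40 * Real.sqrt ep ^ 2 := by ring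
    rw [hexp, hs]
    nlinarith [sq_nonneg ep]
  exact (pow_le_pow_iff_left₀ hm0 hR0 two_ne_zero).mp (hm2.trans hR2)

/-! ### The standing facts about THE minimal solution of (26) -/

omit [CompleteSpace H] in
/-- Auxiliary facts about the setting of (26): `‖y‖ ≤ 1`, `‖y‖² = 1 − ‖x₀ − y‖² − 2εθ ∈ [1/2, 1 − 2εθ]`, the radius
`‖x₀ − (1+δ)y‖ ≤ ‖x₀ − y‖ < 1 = ‖x₀‖`. [cite: Enflo2023, v2 p.4, eq. (8), (10); p.13, eq. (26)] -/
lemma setting (x₀ y : H) (et : ℝ) (h0 : ‖x₀‖ = 1) (ht : (⟪x₀ - y, y⟫_ℂ).re = et)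
    (het0 : 0 ≤ et) (het1 : et ≤ 1 / 10 ^ 4) (hd : ‖x₀ - y‖ ≤ 0.7) :
    ‖y‖ ≤ 1 ∧ 1 / 2 ≤ ‖y‖ ^ 2 ∧ ‖y‖ ^ 2 ≤ 1 - 2 * et ∧
      ‖x₀ - ((1 + et / 10 : ℝ) : ℂ) • y‖ ≤ ‖x₀ - y‖ ∧ ‖x₀ - ((1 + et / 10 : ℝ) : ℂ) • y‖ < ‖x₀‖ := by
  have hysq : ‖y‖ ^ 2 = 1 - ‖x₀ - y‖ ^ 2 - 2 * et := by rw [norm_sq_move x₀ y h0, ht]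
  have hy1 : ‖y‖ ≤ 1 := norm_move_le_one x₀ y h0 (by rw [ht]; exact het0)
  have hd2 : ‖x₀ - y‖ ^ 2 ≤ 0.49 := by nlinarith [norm_nonneg (x₀ - y)]
  have hY : 1 / 2 ≤ ‖y‖ ^ 2 := by rw [hysq]; linarith
  have hY1 : ‖y‖ ^ 2 ≤ 1 - 2 * et := by rw [hysq]; linarith [sq_nonneg ‖x₀ - y‖]
  have hrad : ‖x₀ - ((1 + et / 10 : ℝ) : ℂ) • y‖ ≤ ‖x₀ - y‖ :=
    radius_le_norm_sub x₀ y et ht (by linarith)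
  exact ⟨hy1, hY, hY1, hrad, by rw [h0]; linarith⟩

/-- **The standing facts, derived from minimality** (compare `CaseII.eq27_false_for_minimal`, which derives the
same for the window refutation).  `T` bounded, `‖T‖ ≤ 10⁻²⁰`; `‖x₀‖ = 1`; `εθ = Re⟪x₀ − y, y⟫ ∈ [0, 10⁻⁴]`,
`‖x₀ − y‖ ≤ 0.7`; `a ∈ ℓ²` THE minimal solution of (26) with multiplier `C'` in (5).  With `c = 1 + εθ/10`,
`A = ‖La‖`, `t = T²V_y(L²a)`, `E = Re(a₁⟪y,Ty⟫ + ⟪y,t⟫)`: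
move identity `‖V_y a − c y‖² = 2C'(c·Re a₀ − ‖a‖²)`; head equation `(C' + ‖y‖²)Re a₀ = εθ + ‖y‖² − E`;
`|E| ≤ (10⁻²⁰ + 2·10⁻⁴⁰)A`; `Re a₀ ≤ c`; `(Re a₀)² + A² ≤ ‖a‖² ≤ c²`; `‖a‖² ≥ 0.0899`; `(εθ)' = C'‖a‖²`. [cite: Enflo2023, v2 p.13, eq. (26); p.3, eq. (5)–(6)] -/
theorem minimal_facts (T : H →L[ℂ] H) (hT1 : ‖T‖ < 1) (hT : ‖T‖ ≤ 1 / 10 ^ 20)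
    (x₀ y : H) (et : ℝ) (a : ℓ2) {C : ℝ}
    (h0 : ‖x₀‖ = 1) (ht : (⟪x₀ - y, y⟫_ℂ).re = et) (het0 : 0 ≤ et) (het1 : et ≤ 1 / 10 ^ 4)
    (hd : ‖x₀ - y‖ ≤ 0.7)
    (hmin : IsMinimal (V T hT1 y) x₀ ‖x₀ - ((1 + et / 10 : ℝ) : ℂ) • y‖ a)
    (hC : ContinuousLinearMap.adjoint (V T hT1 y) (x₀ - V T hT1 y a) = (C : ℂ) • a) :
    ‖V T hT1 y a - ((1 + et / 10 : ℝ) : ℂ) • y‖ ^ 2 = 2 * C * ((1 + et / 10) * (a 0).re - ‖a‖ ^ 2)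
    ∧ (C + ‖y‖ ^ 2) * (a 0).re
        = et + ‖y‖ ^ 2 - (a 1 * ⟪y, T y⟫_ℂ + ⟪y, T (T (V T hT1 y (L (L a))))⟫_ℂ).re
    ∧ |(a 1 * ⟪y, T y⟫_ℂ + ⟪y, T (T (V T hT1 y (L (L a))))⟫_ℂ).re|
        ≤ (1 / 10 ^ 20 + 2 / 10 ^ 40) * ‖L a‖
    ∧ (a 0).re ≤ 1 + et / 10
    ∧ (a 0).re ^ 2 + ‖L a‖ ^ 2 ≤ ‖a‖ ^ 2
    ∧ ‖a‖ ^ 2 ≤ (1 + et / 10) ^ 2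
    ∧ 899 / 10000 ≤ ‖a‖ ^ 2
    ∧ (⟪x₀ - V T hT1 y a, V T hT1 y a⟫_ℂ).re = C * ‖a‖ ^ 2 := by
  obtain ⟨hy1, hY, hY1, hrad, hrad1⟩ := setting x₀ y et h0 ht het0 het1 hd
  have hy0 : 0 ≤ ‖y‖ := norm_nonneg y
  -- activity and budget
  have hact : ‖x₀ - V T hT1 y a‖ = ‖x₀ - ((1 + et / 10 : ℝ) : ℂ) • y‖ := hmin.norm_sub_eq hrad1
  have hna : ‖a‖ ≤ 1 + et / 10 :=
    norm_minimal_le_of_smul_feasible T hT1 (by linarith) hmin le_rfl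
  -- ‖V_y‖ ≤ 1.0001, tail bound, ‖Ty‖ ≤ 10⁻²⁰
  have hys : ‖y‖ * Real.sqrt (1 / (1 - ‖T‖ ^ 2)) ≤ 1 + 1 / 10 ^ 4 := norm_y_mul_sqrt_le hT hy1
  have hq0 : 0 ≤ ‖T‖ := norm_nonneg _
  have hq2 : ‖T‖ ^ 2 ≤ 1 / 10 ^ 40 := (pow_le_pow_left₀ hq0 hT 2).trans (by norm_num)
  have hA0 : 0 ≤ ‖L a‖ := norm_nonneg _
  have htl : ‖T (T (V T hT1 y (L (L a))))‖ ≤ 2 / 10 ^ 40 * ‖L a‖ := by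
    calc ‖T (T (V T hT1 y (L (L a))))‖
        ≤ ‖T‖ ^ 2 * (‖y‖ * Real.sqrt (1 / (1 - ‖T‖ ^ 2))) * ‖L a‖ := norm_tail₂_le T hT1 y a
      _ ≤ (1 / 10 ^ 40) * (1 + 1 / 10 ^ 4) * ‖L a‖ := by gcongr
      _ ≤ 2 / 10 ^ 40 * ‖L a‖ := by nlinarith
  have hw : ‖T y‖ ≤ 1 / 10 ^ 20 := norm_apply_le_of_opNorm_le (by norm_num) hT hy1
  -- the error term of the head equation
  have hE : |(a 1 * ⟪y, T y⟫_ℂ + ⟪y, T (T (V T hT1 y (L (L a))))⟫_ℂ).re|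
      ≤ (1 / 10 ^ 20 + 2 / 10 ^ 40) * ‖L a‖ := by
    have h1 := Complex.abs_re_le_norm (a 1 * ⟪y, T y⟫_ℂ + ⟪y, T (T (V T hT1 y (L (L a))))⟫_ℂ)
    have h2 : ‖a 1 * ⟪y, T y⟫_ℂ + ⟪y, T (T (V T hT1 y (L (L a))))⟫_ℂ‖
        ≤ ‖a 1‖ * ‖⟪y, T y⟫_ℂ‖ + ‖⟪y, T (T (V T hT1 y (L (L a))))⟫_ℂ‖ :=
      (norm_add_le _ _).trans (by rw [norm_mul])
    have h5 : ‖a 1‖ * ‖⟪y, T y⟫_ℂ‖ ≤ ‖L a‖ * (1 / 10 ^ 20) := by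
      calc ‖a 1‖ * ‖⟪y, T y⟫_ℂ‖ ≤ ‖L a‖ * (‖y‖ * ‖T y‖) := by
            gcongr
            · exact norm_apply_one_le_norm_L a
            · exact norm_inner_le_norm y (T y)
        _ ≤ ‖L a‖ * (1 * (1 / 10 ^ 20)) := by gcongr
        _ = ‖L a‖ * (1 / 10 ^ 20) := by ring
    have h6 : ‖⟪y, T (T (V T hT1 y (L (L a))))⟫_ℂ‖ ≤ 2 / 10 ^ 40 * ‖L a‖ := by
      calc ‖⟪y, T (T (V T hT1 y (L (L a))))⟫_ℂ‖ ≤ ‖y‖ * ‖T (T (V T hT1 y (L (L a))))‖ :=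
            norm_inner_le_norm _ _
        _ ≤ 1 * (2 / 10 ^ 40 * ‖L a‖) := by gcongr
        _ = 2 / 10 ^ 40 * ‖L a‖ := one_mul _
    linarith
  -- head coefficient facts
  have hu_abs : |(a 0).re| ≤ ‖a 0‖ := Complex.abs_re_le_norm (a 0)
  have hu0n : ‖a 0‖ ≤ ‖a‖ := lp.norm_apply_le_norm (by norm_num) a 0
  have hu_le : (a 0).re ≤ 1 + et / 10 := ((le_abs_self _).trans hu_abs).trans (hu0n.trans hna)
  have hu2 : (a 0).re ^ 2 ≤ ‖a 0‖ ^ 2 := by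
    rw [← sq_abs (a 0).re]; exact pow_le_pow_left₀ (abs_nonneg _) hu_abs 2
  have hsplit : ‖a‖ ^ 2 = ‖a 0‖ ^ 2 + ‖L a‖ ^ 2 := norm_sq_eq_head_add_L a
  have hna2 : ‖a‖ ^ 2 ≤ (1 + et / 10) ^ 2 := pow_le_pow_left₀ (norm_nonneg a) hna 2
  -- ‖a‖ ≥ 0.2999 from ‖V_y a‖ ≥ 1 − 0.7 and ‖V_y‖ ≤ 1.0001
  have hVa : 3 / 10 ≤ ‖V T hT1 y a‖ := by
    have h1 : ‖x₀‖ - ‖x₀ - V T hT1 y a‖ ≤ ‖x₀ - (x₀ - V T hT1 y a)‖ := norm_sub_norm_le _ _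
    rw [sub_sub_cancel, h0, hact] at h1
    linarith
  have hVa' : ‖V T hT1 y a‖ ≤ (1 + 1 / 10 ^ 4) * ‖a‖ :=
    ((V T hT1 y).le_of_opNorm_le (norm_V_le T hT1 y) a).trans (by gcongr)
  have hna0 : 899 / 10000 ≤ ‖a‖ ^ 2 := by nlinarith [norm_nonneg a]
  -- (εθ)' = C‖a‖²
  have hep : (⟪x₀ - V T hT1 y a, V T hT1 y a⟫_ℂ).re = C * ‖a‖ ^ 2 := by
    rw [IsMinimal.eq6 hC, Complex.ofReal_re]
  refine ⟨norm_sq_move_eq T hT1 x₀ y a (1 + et / 10) hC hact, head_re_eq T hT1 x₀ y et a ht hC, hE,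
    hu_le, ?_, hna2, hna0, hep⟩
  linarith

/-! ### The move bound for THE minimal solution of (26) — no (27), no Case II, no window on `⟨y, Ty⟩` -/

/-- **The move bound in terms of the multiplier.**  In the setting of `minimal_facts` (with `C' ≥ 0`),
`‖V_y a − (1+δ)y‖² ≤ 9·C'² + 21·10⁻⁴⁰·C'`, where `C' = (εθ)'/‖ℓ'‖²` is the Lagrange multiplier of (5).
Mechanism: the square of the move is `2C'(c·Re a₀ − ‖a‖²) ≤ 2C'cβ`, `β := c − Re a₀ ≥ 0`; the head equation gives
`(C' + ‖y‖²)β = cC' + (δ‖y‖² − εθ) + E ≤ cC' + |E|` (as `δ‖y‖² ≤ εθ`), and the budget gives `‖La‖² ≤ 2cβ`,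
whence `β ≤ 4cC' + 8c(10⁻²⁰ + 2·10⁻⁴⁰)²`. [cite: Enflo2023, v2 p.13, eq. (26)–(27)] -/
theorem norm_sq_move_le (T : H →L[ℂ] H) (hT1 : ‖T‖ < 1) (hT : ‖T‖ ≤ 1 / 10 ^ 20)
    (x₀ y : H) (et : ℝ) (a : ℓ2) {C : ℝ}
    (h0 : ‖x₀‖ = 1) (ht : (⟪x₀ - y, y⟫_ℂ).re = et) (het0 : 0 ≤ et) (het1 : et ≤ 1 / 10 ^ 4)
    (hd : ‖x₀ - y‖ ≤ 0.7)
    (hmin : IsMinimal (V T hT1 y) x₀ ‖x₀ - ((1 + et / 10 : ℝ) : ℂ) • y‖ a)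
    (hC0 : 0 ≤ C) (hC : ContinuousLinearMap.adjoint (V T hT1 y) (x₀ - V T hT1 y a) = (C : ℂ) • a) :
    ‖V T hT1 y a - ((1 + et / 10 : ℝ) : ℂ) • y‖ ^ 2 ≤ 9 * C ^ 2 + 21 / 10 ^ 40 * C := by
  obtain ⟨-, hY, hY1, -, -⟩ := setting x₀ y et h0 ht het0 het1 hd
  obtain ⟨hid, hre, hE, hu, hsplit, hna, -, -⟩ :=
    minimal_facts T hT1 hT x₀ y et a h0 ht het0 het1 hd hmin hC
  rw [hid]
  exact move_arith C (‖y‖ ^ 2) (1 + et / 10) (a 0).re ‖L a‖ (‖a‖ ^ 2) _ et hC0 hY (by linarith)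
    het0 rfl (by linarith) hu hsplit hna hre hE

/-- **The move bound in terms of the new `εθ`.**  Same setting; if moreover the new
`(εθ)' = Re⟪x₀ − V_y a, V_y a⟫ ≤ 10⁻⁴` (as along any run on which `εθ` decreases), then
`‖ℓ'(T)y₁' − (1+δ)y₁'‖ ≤ 4·(εθ)' + 5·10⁻²⁰·√(εθ)'`.
So WITHOUT (27) the minimal solution of (26) moves `y₁'` (beyond the scaling `δy₁'`) by `O((εθ)' + 10⁻²⁰√(εθ)')` —
not the `(εθ)²` claimed in (27) (refuted: `CaseII.eq27_false_for_minimal`), but small, and summable along any run on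
which `εθ → 0` geometrically.  Consequently (27) is NOT NEEDED for the convergence part of the Case II argument;
what the argument consumes is only the contraction of `εθ` (section `CRun` below). [cite: Enflo2023, v2 p.13, eq. (26)–(27) and the lines after (27)] -/
theorem norm_move_le (T : H →L[ℂ] H) (hT1 : ‖T‖ < 1) (hT : ‖T‖ ≤ 1 / 10 ^ 20)
    (x₀ y : H) (et : ℝ) (a : ℓ2)
    (h0 : ‖x₀‖ = 1) (ht : (⟪x₀ - y, y⟫_ℂ).re = et) (het0 : 0 ≤ et) (het1 : et ≤ 1 / 10 ^ 4)
    (hd : ‖x₀ - y‖ ≤ 0.7)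
    (hmin : IsMinimal (V T hT1 y) x₀ ‖x₀ - ((1 + et / 10 : ℝ) : ℂ) • y‖ a)
    (hsmall : (⟪x₀ - V T hT1 y a, V T hT1 y a⟫_ℂ).re ≤ 1 / 10 ^ 4) :
    ‖V T hT1 y a - ((1 + et / 10 : ℝ) : ℂ) • y‖
      ≤ 4 * (⟪x₀ - V T hT1 y a, V T hT1 y a⟫_ℂ).re
        + 5 / 10 ^ 20 * Real.sqrt ((⟪x₀ - V T hT1 y a, V T hT1 y a⟫_ℂ).re) := by
  obtain ⟨-, hY, -, -, hrad1⟩ := setting x₀ y et h0 ht het0 het1 hd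
  have ha0 : a ≠ 0 := hmin.ne_zero hrad1
  obtain ⟨C, hC0, hC⟩ := hmin.kkt ha0
  obtain ⟨-, hre, hE, hu, hsplit, hna, hna0, hep⟩ :=
    minimal_facts T hT1 hT x₀ y et a h0 ht het0 het1 hd hmin hC
  have hm := norm_sq_move_le T hT1 hT x₀ y et a h0 ht het0 het1 hd hmin hC0 hC
  rw [hep] at hsmall ⊢
  exact move_arith₂ C (‖y‖ ^ 2) (1 + et / 10) (a 0).re ‖L a‖ (‖a‖ ^ 2) _ et (C * ‖a‖ ^ 2) _ hC0 hY
    het0 rfl (by linarith) (norm_nonneg _) hu hsplit hna hna0 hre hE rfl hsmall (norm_nonneg _) hm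

/-! ### The Case II run with the CONTRACTION of `εθ` as the only hypothesis: (27) is not needed for the convergence -/

section CRun

variable (T : H →L[ℂ] H) (hT : ‖T‖ < 1) (hT20 : ‖T‖ ≤ 1 / 10 ^ 20) (x₀ : H) (y : ℕ → H) (a : ℕ → ℓ2)
  (t : ℕ → ℝ) (r : ℝ)
  (hx₀ : ‖x₀‖ = 1) (ht : ∀ n, (⟪x₀ - y n, y n⟫_ℂ).re = t n) (ht0 : 0 ≤ t 0) (ht1 : t 0 ≤ 1 / 10 ^ 4)
  (hr0 : 0 ≤ r) (hr1 : r < 1) (ht2 : 100 * t 0 ^ 2 ≤ 1 - r)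
  (hwin : 0.3 ≤ ‖x₀ - y 0‖ ∧ ‖x₀ - y 0‖ ≤ 0.7)
  (hmin : ∀ n, IsMinimal (V T hT (y n)) x₀ ‖x₀ - ((1 + t n / 10 : ℝ) : ℂ) • y n‖ (a n))
  (hsucc : ∀ n, y (n + 1) = V T hT (y n) (a n))
  (hcontr : ∀ n, t (n + 1) ≤ r * t n)

include hx₀ ht ht0 ht1 hr0 hr1 ht2 hwin hmin hsucc hcontr hT20

omit hT20 ht1 hr1 ht2 in
/-- **Run invariant under the contraction hypothesis.**  Along the Case II iteration (`y (n+1) = ℓ'(T)y_n`, the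
minimal solution of (26)) with `(εθ)_{n+1} ≤ r·(εθ)_n` granted (`0 ≤ r < 1`; the text has `r = 1 − 1/20`):
`0 ≤ (εθ)_n ≤ rⁿ(εθ)₀` and `‖x₀ − y n‖ ≤ 0.7`.  ((27) is NOT assumed.) [cite: Enflo2023, v2 p.13, lines after eq. (27)] -/
theorem crun_invariant : ∀ n, 0 ≤ t n ∧ t n ≤ r ^ n * t 0 ∧ ‖x₀ - y n‖ ≤ 0.7 := by
  intro n
  induction n with
  | zero => exact ⟨ht0, by simp, hwin.2⟩
  | succ n ih =>
    obtain ⟨hn0, hnle, hnd⟩ := ih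
    have hy1 : ‖y n‖ ≤ 1 := norm_move_le_one x₀ (y n) hx₀ (by rw [ht n]; exact hn0)
    have hy20 : ‖y n‖ ^ 2 ≤ 20 := by nlinarith [norm_nonneg (y n)]
    have hrad : ‖x₀ - ((1 + t n / 10 : ℝ) : ℂ) • y n‖ ≤ ‖x₀ - y n‖ :=
      radius_le_norm_sub x₀ (y n) (t n) (ht n) hy20
    have hrad1 : ‖x₀ - ((1 + t n / 10 : ℝ) : ℂ) • y n‖ < ‖x₀‖ := by rw [hx₀]; linarith
    have ha0 : a n ≠ 0 := (hmin n).ne_zero hrad1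
    obtain ⟨C, hC0, hC⟩ := (hmin n).kkt ha0
    have hpos : 0 ≤ (⟪x₀ - V T hT (y n) (a n), V T hT (y n) (a n)⟫_ℂ).re :=
      IsMinimal.etheta_nonneg hC0 hC
    refine ⟨?_, ?_, ?_⟩
    · rw [← ht (n + 1), hsucc n]; exact hpos
    · calc t (n + 1) ≤ r * t n := hcontr n
        _ ≤ r * (r ^ n * t 0) := by gcongr
        _ = r ^ (n + 1) * t 0 := by ring
    · calc ‖x₀ - y (n + 1)‖ = ‖x₀ - V T hT (y n) (a n)‖ := by rw [hsucc n]
        _ ≤ ‖x₀ - ((1 + t n / 10 : ℝ) : ℂ) • y n‖ := (hmin n).norm_sub_le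
        _ ≤ ‖x₀ - y n‖ := hrad
        _ ≤ 0.7 := hnd

omit hT20 ht1 ht2 in
/-- The distances to `x₀` cannot collapse: since the constraint of (26) is active at the minimal solution,
`‖x₀ − y(n+1)‖² = ‖x₀ − (1+δ_n)y n‖² = ‖x₀ − y n‖² − (εθ)_n²/5 + (εθ)_n²‖y n‖²/100 ≥ ‖x₀ − y n‖² − (εθ)_n²/5`,
and `Σ (εθ)_n² ≤ (εθ)₀²/(1 − r)`; in invariant form:
`5(1−r)‖x₀ − y n‖² − (εθ)_n² ≥ 5(1−r)‖x₀ − y 0‖² − (εθ)₀²`. [cite: Enflo2023, v2 p.13, eq. (26); p.4, eq. (10)] -/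
theorem crun_dist_sq_invariant : ∀ n,
    5 * (1 - r) * ‖x₀ - y 0‖ ^ 2 - t 0 ^ 2 ≤ 5 * (1 - r) * ‖x₀ - y n‖ ^ 2 - t n ^ 2 := by
  intro n
  induction n with
  | zero => exact le_rfl
  | succ n ih =>
    obtain ⟨hn0, -, hnd⟩ := crun_invariant T hT x₀ y a t r hx₀ ht ht0 hr0 hwin hmin hsucc hcontr n
    obtain ⟨hn0', -, -⟩ := crun_invariant T hT x₀ y a t r hx₀ ht ht0 hr0 hwin hmin hsucc hcontr (n + 1)
    have hy1 : ‖y n‖ ≤ 1 := norm_move_le_one x₀ (y n) hx₀ (by rw [ht n]; exact hn0)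
    have hy20 : ‖y n‖ ^ 2 ≤ 20 := by nlinarith [norm_nonneg (y n)]
    have hrad : ‖x₀ - ((1 + t n / 10 : ℝ) : ℂ) • y n‖ ≤ ‖x₀ - y n‖ :=
      radius_le_norm_sub x₀ (y n) (t n) (ht n) hy20
    have hrad1 : ‖x₀ - ((1 + t n / 10 : ℝ) : ℂ) • y n‖ < ‖x₀‖ := by rw [hx₀]; linarith
    have hact : ‖x₀ - y (n + 1)‖ = ‖x₀ - ((1 + t n / 10 : ℝ) : ℂ) • y n‖ := by
      rw [hsucc n]; exact (hmin n).norm_sub_eq hrad1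
    have hsq : ‖x₀ - ((1 + t n / 10 : ℝ) : ℂ) • y n‖ ^ 2
        = ‖x₀ - y n‖ ^ 2 - 2 * (t n / 10) * t n + (t n / 10) ^ 2 * ‖y n‖ ^ 2 := by
      rw [Lemma1.norm_sub_add_smul_sq x₀ (y n) (t n / 10), ht n]
    have hD : ‖x₀ - y n‖ ^ 2 - t n ^ 2 / 5 ≤ ‖x₀ - y (n + 1)‖ ^ 2 := by
      rw [hact, hsq]; nlinarith [sq_nonneg (t n / 10 * ‖y n‖)]
    have ht2' : t (n + 1) ^ 2 ≤ r * t n ^ 2 := by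
      have h2 : t (n + 1) ^ 2 ≤ (r * t n) ^ 2 := pow_le_pow_left₀ hn0' (hcontr n) 2
      have h3 : r ^ 2 ≤ r := by nlinarith
      nlinarith [sq_nonneg (t n)]
    have h5 : 5 * (1 - r) * (‖x₀ - y n‖ ^ 2 - t n ^ 2 / 5) ≤ 5 * (1 - r) * ‖x₀ - y (n + 1)‖ ^ 2 :=
      mul_le_mul_of_nonneg_left hD (by linarith)
    nlinarith [ih, h5, ht2']

omit hT20 ht1 in
/-- Hence `‖x₀ − y n‖² ≥ 0.088` along the run (`‖x₀ − y 0‖ ≥ 0.3`, `100(εθ)₀² ≤ 1 − r`). [cite: Enflo2023, v2 p.13 with p.4 (‖x₀ − ℓ'(T)y'‖ ≥ 0.3)] -/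
theorem crun_norm_sub_sq_ge (n : ℕ) : 0.088 ≤ ‖x₀ - y n‖ ^ 2 := by
  have h := crun_dist_sq_invariant T hT x₀ y a t r hx₀ ht ht0 hr0 hr1 hwin hmin hsucc hcontr n
  have h1 : 0.09 ≤ ‖x₀ - y 0‖ ^ 2 := by nlinarith [hwin.1]
  have hr' : 0 < 5 * (1 - r) := by linarith
  have h2 : 5 * (1 - r) * 0.088 ≤ 5 * (1 - r) * ‖x₀ - y n‖ ^ 2 := by
    nlinarith [sq_nonneg (t n), mul_le_mul_of_nonneg_left h1 hr'.le]
  exact le_of_mul_le_mul_left h2 hr'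

omit ht2 in
/-- **The moves are geometrically summable WITHOUT (27)**: by `norm_move_le` and the scaling `δ_n y n`,
`‖y(n+1) − y n‖ ≤ (εθ)_n/10 + 4(εθ)_{n+1} + 5·10⁻²⁰√(εθ)_{n+1} ≤ (4.1(εθ)₀ + 5·10⁻²⁰√(εθ)₀)·(√r)ⁿ`. [cite: Enflo2023, v2 p.13 ("not moving more than (εθ)²" — here replaced by the proved move bound)] -/
theorem crun_move_le (n : ℕ) :
    dist (y n) (y (n + 1)) ≤ (41 / 10 * t 0 + 5 / 10 ^ 20 * Real.sqrt (t 0)) * Real.sqrt r ^ n := by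
  obtain ⟨hn0, hnle, hnd⟩ := crun_invariant T hT x₀ y a t r hx₀ ht ht0 hr0 hwin hmin hsucc hcontr n
  have hpow1 : r ^ n ≤ 1 := pow_le_one₀ hr0 hr1.le
  have htn0 : t n ≤ t 0 := hnle.trans (mul_le_of_le_one_left ht0 hpow1)
  have htn1 : t n ≤ 1 / 10 ^ 4 := htn0.trans ht1
  have ht1n : t (n + 1) ≤ t n := (hcontr n).trans (mul_le_of_le_one_left hn0 hr1.le)
  have hy1 : ‖y n‖ ≤ 1 := norm_move_le_one x₀ (y n) hx₀ (by rw [ht n]; exact hn0)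
  -- the move bound for the minimal solution `a n`
  have hεθ : (⟪x₀ - V T hT (y n) (a n), V T hT (y n) (a n)⟫_ℂ).re = t (n + 1) := by
    rw [← hsucc n]; exact ht (n + 1)
  have hmove := norm_move_le T hT hT20 x₀ (y n) (t n) (a n) hx₀ (ht n) hn0 htn1 hnd (hmin n)
    (by rw [hεθ]; exact ht1n.trans htn1)
  rw [hεθ, ← hsucc n] at hmove
  -- displacement ≤ move + (εθ)_n/10 · ‖y n‖
  have hdisp : ‖y (n + 1) - y n‖
      ≤ ‖y (n + 1) - ((1 + t n / 10 : ℝ) : ℂ) • y n‖ + t n / 10 * ‖y n‖ := by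
    have h1 : y (n + 1) - y n
        = (y (n + 1) - ((1 + t n / 10 : ℝ) : ℂ) • y n) + ((t n / 10 : ℝ) : ℂ) • y n := by
      push_cast; rw [add_smul, one_smul]; abel
    rw [h1]
    calc ‖(y (n + 1) - ((1 + t n / 10 : ℝ) : ℂ) • y n) + ((t n / 10 : ℝ) : ℂ) • y n‖
        ≤ ‖y (n + 1) - ((1 + t n / 10 : ℝ) : ℂ) • y n‖ + ‖((t n / 10 : ℝ) : ℂ) • y n‖ := norm_add_le _ _
      _ = ‖y (n + 1) - ((1 + t n / 10 : ℝ) : ℂ) • y n‖ + t n / 10 * ‖y n‖ := by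
          rw [norm_smul, Complex.norm_real, Real.norm_of_nonneg (by positivity)]
  -- geometric majorants with ratio √r
  have hs0 : 0 ≤ Real.sqrt r := Real.sqrt_nonneg r
  have hrs : r ≤ Real.sqrt r := (Real.le_sqrt hr0 hr0).2 (by nlinarith)
  have hpow : r ^ n ≤ Real.sqrt r ^ n := pow_le_pow_left₀ hr0 hrs n
  have htn : t n ≤ Real.sqrt r ^ n * t 0 := hnle.trans (mul_le_mul_of_nonneg_right hpow ht0)
  have ht1n' : t (n + 1) ≤ Real.sqrt r ^ n * t 0 := ht1n.trans htn
  have hsq : Real.sqrt (t (n + 1)) ≤ Real.sqrt r ^ n * Real.sqrt (t 0) := by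
    have h0 : (Real.sqrt r ^ n) ^ 2 = r ^ n := by
      rw [← pow_mul, mul_comm, pow_mul, Real.sq_sqrt hr0]
    have h1 : t (n + 1) ≤ (Real.sqrt r ^ n * Real.sqrt (t 0)) ^ 2 := by
      rw [mul_pow, h0, Real.sq_sqrt ht0]; exact ht1n.trans hnle
    calc Real.sqrt (t (n + 1)) ≤ Real.sqrt ((Real.sqrt r ^ n * Real.sqrt (t 0)) ^ 2) :=
          Real.sqrt_le_sqrt h1
      _ = Real.sqrt r ^ n * Real.sqrt (t 0) := Real.sqrt_sq (by positivity)
  have hc : t n / 10 * ‖y n‖ ≤ Real.sqrt r ^ n * t 0 / 10 := by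
    calc t n / 10 * ‖y n‖ ≤ t n / 10 * 1 := mul_le_mul_of_nonneg_left hy1 (by linarith)
      _ ≤ Real.sqrt r ^ n * t 0 / 10 := by linarith
  have hb : 5 / 10 ^ 20 * Real.sqrt (t (n + 1)) ≤ 5 / 10 ^ 20 * (Real.sqrt r ^ n * Real.sqrt (t 0)) :=
    mul_le_mul_of_nonneg_left hsq (by norm_num)
  rw [dist_comm, dist_eq_norm]
  calc ‖y (n + 1) - y n‖
      ≤ (4 * t (n + 1) + 5 / 10 ^ 20 * Real.sqrt (t (n + 1))) + t n / 10 * ‖y n‖ := by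
        linarith [hdisp, hmove]
    _ ≤ (4 * (Real.sqrt r ^ n * t 0) + 5 / 10 ^ 20 * (Real.sqrt r ^ n * Real.sqrt (t 0)))
          + Real.sqrt r ^ n * t 0 / 10 := by linarith [ht1n', hb, hc]
    _ = (41 / 10 * t 0 + 5 / 10 ^ 20 * Real.sqrt (t 0)) * Real.sqrt r ^ n := by ring

/-- **"we obtain convergence to a non-cyclic vector" — from the contraction alone, WITHOUT (27).**  The run converges
in norm (Cauchy with geometric majorant of ratio `√r < 1`, `H` complete) to `y_∞` with `‖x₀ − y_∞‖ ≤ 0.7` (so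
`y_∞ ≠ 0`), `‖x₀ − y_∞‖² ≥ 0.088` (so `x₀ − y_∞ ≠ 0`), and `⟨x₀ − y_∞, T^j y_∞⟩ = 0` for all `j ≥ 0` — by (9) for each
minimal move (`Vy.eq9_pow`, bound `(εθ)_{n+1} → 0`) and the limit step (11) (`orbit_orthogonal_of_norm_limit`).
Compare `CaseII.run_tendsto` / `run_limit_orthogonal` / `run_limit_sub_ne_zero`, which assumed (27). [cite: Enflo2023, v2 p.13, last sentence before the Remark; eq. (9), (11)] -/
theorem crun_limit : ∃ ylim : H, Tendsto y atTop (𝓝 ylim) ∧ ‖x₀ - ylim‖ ≤ 0.7 ∧ (0.088 : ℝ) ≤ ‖x₀ - ylim‖ ^ 2 ∧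
    ylim ≠ 0 ∧ x₀ - ylim ≠ 0 ∧ ∀ j : ℕ, ⟪x₀ - ylim, (T ^ j) ylim⟫_ℂ = 0 := by
  have hinv := crun_invariant T hT x₀ y a t r hx₀ ht ht0 hr0 hwin hmin hsucc hcontr
  -- norm convergence
  obtain ⟨ylim, hlim⟩ : ∃ ylim : H, Tendsto y atTop (𝓝 ylim) :=
    cauchySeq_tendsto_of_complete
      (cauchySeq_of_le_geometric (Real.sqrt r) (41 / 10 * t 0 + 5 / 10 ^ 20 * Real.sqrt (t 0))
        ((Real.sqrt_lt' zero_lt_one).2 (by rw [one_pow]; exact hr1))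
        (crun_move_le T hT hT20 x₀ y a t r hx₀ ht ht0 ht1 hr0 hr1 hwin hmin hsucc hcontr))
  -- distances in the limit
  have hd : Tendsto (fun n => ‖x₀ - y n‖) atTop (𝓝 ‖x₀ - ylim‖) :=
    ((continuous_const.sub continuous_id).norm.tendsto ylim).comp hlim
  have hle : ‖x₀ - ylim‖ ≤ 0.7 := le_of_tendsto' hd fun n => (hinv n).2.2
  have hge : (0.088 : ℝ) ≤ ‖x₀ - ylim‖ ^ 2 :=
    ge_of_tendsto' ((continuous_pow 2).tendsto _ |>.comp hd) fun n =>
      crun_norm_sub_sq_ge T hT x₀ y a t r hx₀ ht ht0 hr0 hr1 ht2 hwin hmin hsucc hcontr n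
  have hne : ylim ≠ 0 := ne_zero_of_norm_sub_lt_one hx₀ (by linarith)
  have hsub : x₀ - ylim ≠ 0 := by
    intro h0; rw [h0, norm_zero] at hge; norm_num at hge
  -- orthogonality via (9) + (11)
  have hε' : Tendsto t atTop (𝓝 0) := by
    refine squeeze_zero (fun n => (hinv n).1) (fun n => (hinv n).2.1) ?_
    simpa using (tendsto_pow_atTop_nhds_zero_of_lt_one hr0 hr1).mul_const (t 0)
  have hε : Tendsto (fun n => t (n + 1)) atTop (𝓝 0) := hε'.comp (tendsto_add_atTop_nat 1)
  have h9 : ∀ n j, ‖⟪x₀ - y (n + 1), (T ^ j) (y (n + 1))⟫_ℂ‖ ≤ t (n + 1) := by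
    intro n j
    obtain ⟨hn0, -, hnd⟩ := hinv n
    have hy1 : ‖y n‖ ≤ 1 := norm_move_le_one x₀ (y n) hx₀ (by rw [ht n]; exact hn0)
    have hy20 : ‖y n‖ ^ 2 ≤ 20 := by nlinarith [norm_nonneg (y n)]
    have hrad : ‖x₀ - ((1 + t n / 10 : ℝ) : ℂ) • y n‖ ≤ ‖x₀ - y n‖ :=
      radius_le_norm_sub x₀ (y n) (t n) (ht n) hy20
    have ha0 : a n ≠ 0 := (hmin n).ne_zero (by rw [hx₀]; linarith)
    have h := eq9_pow T hT (y n) x₀ _ (a n) (hmin n) ha0 j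
    have ht' := ht (n + 1)
    rw [hsucc n] at ht' ⊢
    rw [ht'] at h
    exact h
  have horth := orbit_orthogonal_of_norm_limit T x₀ (fun n => y (n + 1)) ylim (fun n => t (n + 1))
    (hlim.comp (tendsto_add_atTop_nat 1)) hε h9
  exact ⟨ylim, hlim, hle, hge, hne, hsub, horth⟩

end CRun

/-- **Row A26 re-packaged: the contraction of `εθ` along the run — not (27) — is what the Case II branch needs.**
If `‖T‖ ≤ 10⁻²⁰`, `‖x₀‖ = 1`, `y₀` in the window `0.3 ≤ ‖x₀ − y₀‖ ≤ 0.7` with `0 ≤ (εθ)₀ ≤ 10⁻⁴`, `0 ≤ r < 1` with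
`100(εθ)₀² ≤ 1 − r`, and along every Case II iteration started at `y₀` (`y(n+1) = ℓ'(T)y_n` minimal for (26)) the new
`εθ` is at most `r` times the old one, then `T` has a non-trivial closed invariant subspace.  The iteration always
exists (`CaseII.exists_run`); the hypothesis `hcontr` is the manuscript's "pass to a smaller `εθ`, diminished by a
factor `(1 − 1/20)`" with a general factor — the ONLY unproved ingredient. [cite: Enflo2023, v2 p.13, eq. (26)–(27) and the lines after (27)] -/
theorem hasNontrivialClosedInvariantSubspace_of_contraction_along_runs (T : H →L[ℂ] H)
    (hT : ‖T‖ < 1) (hT20 : ‖T‖ ≤ 1 / 10 ^ 20) (x₀ y₀ : H) (hx₀ : ‖x₀‖ = 1)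
    (hwin : 0.3 ≤ ‖x₀ - y₀‖ ∧ ‖x₀ - y₀‖ ≤ 0.7)
    (ht0 : 0 ≤ (⟪x₀ - y₀, y₀⟫_ℂ).re) (ht1 : (⟪x₀ - y₀, y₀⟫_ℂ).re ≤ 1 / 10 ^ 4)
    (r : ℝ) (hr0 : 0 ≤ r) (hr1 : r < 1) (ht2 : 100 * (⟪x₀ - y₀, y₀⟫_ℂ).re ^ 2 ≤ 1 - r)
    (hcontr : ∀ (y : ℕ → H) (a : ℕ → ℓ2), y 0 = y₀ →
      (∀ n, IsMinimal (V T hT (y n)) x₀ ‖x₀ - ((1 + (⟪x₀ - y n, y n⟫_ℂ).re / 10 : ℝ) : ℂ) • y n‖ (a n) ∧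
        y (n + 1) = V T hT (y n) (a n)) →
      ∀ n, (⟪x₀ - y (n + 1), y (n + 1)⟫_ℂ).re ≤ r * (⟪x₀ - y n, y n⟫_ℂ).re) :
    HasNontrivialClosedInvariantSubspace T := by
  obtain ⟨y, a, hy0, hrun⟩ := exists_run T hT x₀ y₀
  have hc := hcontr y a hy0 hrun
  subst hy0
  obtain ⟨ylim, -, -, -, hne, hsub, horth⟩ := crun_limit T hT hT20 x₀ y a (fun n => (⟪x₀ - y n, y n⟫_ℂ).re) r
    hx₀ (fun n => rfl) ht0 ht1 hr0 hr1 ht2 hwin (fun n => (hrun n).1) (fun n => (hrun n).2) hc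
  exact hasNontrivialClosedInvariantSubspace_of_orbit_orthogonal' T hne hsub horth

/-- **The text's own factor.**  With `r = 1 − 1/20` and `(εθ)₀ ≤ 10⁻⁴` the side condition `100(εθ)₀² ≤ 1 − r` is
automatic: if along every Case II iteration started at `y₀` (in the window) "`(εθ)' < εθ(1 − 1/20)`" holds, then `T`
has a non-trivial closed invariant subspace — (27) itself is not needed.  What remains unproved in the manuscript's
Case II branch is therefore precisely this contraction for the minimal solution of (26). [cite: Enflo2023, v2 p.13 ("diminished by a factor (1 − 1/20)")] -/
theorem hasNontrivialClosedInvariantSubspace_of_factor_along_runs (T : H →L[ℂ] H)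
    (hT : ‖T‖ < 1) (hT20 : ‖T‖ ≤ 1 / 10 ^ 20) (x₀ y₀ : H) (hx₀ : ‖x₀‖ = 1)
    (hwin : 0.3 ≤ ‖x₀ - y₀‖ ∧ ‖x₀ - y₀‖ ≤ 0.7)
    (ht0 : 0 ≤ (⟪x₀ - y₀, y₀⟫_ℂ).re) (ht1 : (⟪x₀ - y₀, y₀⟫_ℂ).re ≤ 1 / 10 ^ 4)
    (hcontr : ∀ (y : ℕ → H) (a : ℕ → ℓ2), y 0 = y₀ →
      (∀ n, IsMinimal (V T hT (y n)) x₀ ‖x₀ - ((1 + (⟪x₀ - y n, y n⟫_ℂ).re / 10 : ℝ) : ℂ) • y n‖ (a n) ∧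
        y (n + 1) = V T hT (y n) (a n)) →
      ∀ n, (⟪x₀ - y (n + 1), y (n + 1)⟫_ℂ).re ≤ (19 / 20) * (⟪x₀ - y n, y n⟫_ℂ).re) :
    HasNontrivialClosedInvariantSubspace T :=
  hasNontrivialClosedInvariantSubspace_of_contraction_along_runs T hT hT20 x₀ y₀ hx₀ hwin ht0 ht1 (19 / 20)
    (by norm_num) (by norm_num) (by nlinarith [mul_le_mul ht1 ht1 ht0 (by norm_num : (0:ℝ) ≤ 1 / 10 ^ 4)])
    hcontr

/-! ### Towards the contraction: the structure of THE minimiser (exact identities; Case II enters only where stated) -/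

/-- (5) at `j = 0` in displacement form (no Case II needed): `C'a₀ = ⟨y, x₀ − y⟩ − ⟨y, w⟩`, `w := ℓ'(T)y − y` the
total displacement (scaling included). [cite: Enflo2023, v2 p.3, eq. (5); p.13, eq. (26)] -/
theorem kkt_head_displacement (T : H →L[ℂ] H) (hT : ‖T‖ < 1) (x₀ y : H) (a : ℓ2) {C : ℝ}
    (hC : ContinuousLinearMap.adjoint (V T hT y) (x₀ - V T hT y a) = (C : ℂ) • a) :
    (C : ℂ) * a 0 = ⟪y, x₀ - y⟫_ℂ - ⟪y, V T hT y a - y⟫_ℂ := by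
  have h := kkt_coord T hT y x₀ a hC 0
  rw [pow_zero, one_apply_eq_self] at h
  rw [← h, ← inner_sub_right]
  congr 1
  abel

/-- Real part: `C'·Re a₀ = εθ − Re⟨y, w⟩`.  With (6), `(εθ)' = C'‖a‖²`, this reads
`(εθ)' = (‖a‖²/Re a₀)·(εθ − Re⟨y, w⟩)` with `‖a‖²/Re a₀ ∈ [0.99, 1.003]` (`minimal_facts`): up to a factor
`1 + O(10⁻²)`, THE FACTOR BY WHICH `εθ` CONTRACTS IS `1 − Re⟨y, ℓ'(T)y − y⟩/εθ` — the progress of the move ALONG `y`.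
For the pure scaling `w = δy` the progress is `δ‖y‖² = εθ‖y‖²/10 ≥ εθ/20` precisely because `‖y‖² ≥ 1/2`
(`‖x₀ − y‖ ≤ 0.7`, (10)) — this is where the text's `1 − 1/20` comes from; the coefficient-norm minimisation (26)
spends its freedom `a₁, a₂, …` on REDUCING that progress (packet `REPAIR-CENSUS.md`, F1-V8). [cite: Enflo2023, v2 p.3, eq. (5)–(6); p.13 ("diminished by a factor (1 − 1/20)")] -/
theorem mul_re_head_eq_sub (T : H →L[ℂ] H) (hT : ‖T‖ < 1) (x₀ y : H) (et : ℝ) (a : ℓ2) {C : ℝ}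
    (ht : (⟪x₀ - y, y⟫_ℂ).re = et)
    (hC : ContinuousLinearMap.adjoint (V T hT y) (x₀ - V T hT y a) = (C : ℂ) • a) :
    C * (a 0).re = et - (⟪y, V T hT y a - y⟫_ℂ).re := by
  have h := congrArg Complex.re (kkt_head_displacement T hT x₀ y a hC)
  have h1 := inner_re_symm (𝕜 := ℂ) y (x₀ - y)
  simp only [RCLike.re_to_complex] at h1
  simp only [Complex.mul_re, Complex.ofReal_re, Complex.ofReal_im, zero_mul, sub_zero, Complex.sub_re] at h
  rw [h1, ht] at h
  exact h

/-- (5) at an index `j` for which Case II holds EXACTLY (`⟨T^j y, x₀ − y⟩ = 0`): `C'a_j = −⟨T^j y, w⟩` — the `j`-th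
coefficient of THE minimiser is (up to `−1/C'`) the correlation of the displacement with `T^j y`.  With the head
equation this is the Tikhonov system `(C' + V†V)(a − e₀) = (⟨y, x₀ − y⟩ − C')·e₀`: under exact Case II THE minimiser
of (26) is `a = e₀ + (εθ − C')(C' + V_y†V_y)⁻¹e₀`, the parameter `C'` being fixed by the ACTIVE constraint
(discrepancy principle).  This is the object a proof (or refutation) of the contraction has to control. [cite: Enflo2023, v2 p.3, eq. (5); p.12, Case II; p.13, eq. (26)] -/
theorem kkt_coeff_of_orthogonal (T : H →L[ℂ] H) (hT : ‖T‖ < 1) (x₀ y : H) (a : ℓ2) {C : ℝ}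
    (hC : ContinuousLinearMap.adjoint (V T hT y) (x₀ - V T hT y a) = (C : ℂ) • a) {j : ℕ}
    (hII : ⟪(T ^ j) y, x₀ - y⟫_ℂ = 0) :
    (C : ℂ) * a j = -⟪(T ^ j) y, V T hT y a - y⟫_ℂ := by
  have h := kkt_coord T hT y x₀ a hC j
  have h2 : x₀ - V T hT y a = (x₀ - y) - (V T hT y a - y) := by abel
  rw [h2, inner_sub_right, hII, zero_sub] at h
  exact h.symm

/-- Under EXACT Case II for all `j ≥ 1` (and `⟨x₀ − y, y⟩ = εθ` real, as in the text) the direction `x₀ − y` sees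
only the head coefficient: `⟨x₀ − y, ℓ'(T)y⟩ = a₀·εθ`. [cite: Enflo2023, v2 p.12, Case II; p.13, eq. (26)] -/
theorem inner_sub_V_of_caseII_exact (T : H →L[ℂ] H) (hT : ‖T‖ < 1) (x₀ y : H) (et : ℝ) (a : ℓ2)
    (ht : ⟪x₀ - y, y⟫_ℂ = et) (hII : ∀ j, 1 ≤ j → ⟪x₀ - y, (T ^ j) y⟫_ℂ = 0) :
    ⟪x₀ - y, V T hT y a⟫_ℂ = a 0 * et := by
  classical
  rw [← inner_conj_symm, inner_V_left]
  have hterm : ∀ j, (starRingEnd ℂ) (a j) * ⟪(T ^ j) y, x₀ - y⟫_ℂ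
      = if j = 0 then (starRingEnd ℂ) (a 0) * (et : ℂ) else 0 := by
    intro j
    by_cases hj : j = 0
    · subst hj
      rw [if_pos rfl, pow_zero, one_apply_eq_self, ← inner_conj_symm, ht, Complex.conj_ofReal]
    · rw [if_neg hj, ← inner_conj_symm, hII j (Nat.one_le_iff_ne_zero.2 hj), map_zero, mul_zero]
  rw [tsum_congr hterm, tsum_ite_eq]
  simp [Complex.conj_ofReal]

/-- **The displacement is pinned by activity (exact Case II).**  `w := ℓ'(T)y − y` satisfies
`‖w‖² = δ²‖y‖² − 2εθ((1+δ) − Re a₀)`, `δ = εθ/10`; in particular `‖ℓ'(T)y − y‖ ≤ δ‖y‖ = (εθ/10)‖y‖` and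
`0 ≤ (1+δ) − Re a₀ ≤ εθ‖y‖²/200`.  (Expand `‖x₀ − ℓ'(T)y‖² = ‖(x₀ − y) − w‖²`, use activity
`= ‖x₀ − (1+δ)y‖²` and `Re⟨x₀ − y, w⟩ = (Re a₀ − 1)εθ` from `inner_sub_V_of_caseII_exact`.)  So under Case II the
scaling `δy` is essentially the whole move; compare (27) (which subtracts the scaling and claims `(εθ)²`). [cite: Enflo2023, v2 p.13, eq. (26)–(27)] -/
theorem norm_sq_displacement_eq (T : H →L[ℂ] H) (hT : ‖T‖ < 1) (x₀ y : H) (et : ℝ) (a : ℓ2)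
    (ht : ⟪x₀ - y, y⟫_ℂ = et) (hII : ∀ j, 1 ≤ j → ⟪x₀ - y, (T ^ j) y⟫_ℂ = 0)
    (hact : ‖x₀ - V T hT y a‖ = ‖x₀ - ((1 + et / 10 : ℝ) : ℂ) • y‖) :
    ‖V T hT y a - y‖ ^ 2 = (et / 10) ^ 2 * ‖y‖ ^ 2 - 2 * et * ((1 + et / 10) - (a 0).re) := by
  have hre : (⟪x₀ - y, y⟫_ℂ).re = et := by rw [ht, Complex.ofReal_re]
  have hw : (⟪x₀ - y, V T hT y a - y⟫_ℂ).re = ((a 0).re - 1) * et := by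
    rw [inner_sub_right, inner_sub_V_of_caseII_exact T hT x₀ y et a ht hII, ht]
    simp [Complex.mul_re]
    ring
  have h1 : ‖x₀ - V T hT y a‖ ^ 2
      = ‖x₀ - y‖ ^ 2 - 2 * (⟪x₀ - y, V T hT y a - y⟫_ℂ).re + ‖V T hT y a - y‖ ^ 2 := by
    have h := norm_sub_sq (𝕜 := ℂ) (x₀ - y) (V T hT y a - y)
    rw [sub_sub_sub_cancel_right] at h
    simpa only [RCLike.re_to_complex] using h
  have h2 : ‖x₀ - ((1 + et / 10 : ℝ) : ℂ) • y‖ ^ 2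
      = ‖x₀ - y‖ ^ 2 - 2 * (et / 10) * et + (et / 10) ^ 2 * ‖y‖ ^ 2 := by
    rw [Lemma1.norm_sub_add_smul_sq x₀ y (et / 10), hre]
  rw [hact, h2, hw] at h1
  linarith

/-- Corollary: `‖ℓ'(T)y − y‖ ≤ (εθ/10)‖y‖` and `(1+δ) − Re a₀ ≤ εθ‖y‖²/200` for THE minimiser under exact Case II
(`Re a₀ ≤ 1+δ` is `minimal_facts`). [cite: Enflo2023, v2 p.13, eq. (26)–(27)] -/
theorem norm_displacement_le (T : H →L[ℂ] H) (hT : ‖T‖ < 1) (x₀ y : H) (et : ℝ) (a : ℓ2)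
    (ht : ⟪x₀ - y, y⟫_ℂ = et) (het0 : 0 ≤ et) (hII : ∀ j, 1 ≤ j → ⟪x₀ - y, (T ^ j) y⟫_ℂ = 0)
    (hact : ‖x₀ - V T hT y a‖ = ‖x₀ - ((1 + et / 10 : ℝ) : ℂ) • y‖) (hu : (a 0).re ≤ 1 + et / 10) :
    ‖V T hT y a - y‖ ≤ et / 10 * ‖y‖ ∧ 2 * et * ((1 + et / 10) - (a 0).re) ≤ (et / 10) ^ 2 * ‖y‖ ^ 2 := by
  have h := norm_sq_displacement_eq T hT x₀ y et a ht hII hact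
  have hy0 : 0 ≤ ‖y‖ := norm_nonneg y
  have h2 : ‖V T hT y a - y‖ ^ 2 ≤ (et / 10 * ‖y‖) ^ 2 := by
    rw [h]; nlinarith [mul_nonneg het0 (sub_nonneg.2 hu)]
  refine ⟨(pow_le_pow_iff_left₀ (norm_nonneg _) (by positivity) two_ne_zero).mp h2, ?_⟩
  nlinarith [sq_nonneg ‖V T hT y a - y‖]

end CaseII

end Literature.Analysis.OperatorTheory.Enflo2023

end
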